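import Summits.Ventures.Crystal3D.Theorems.StickyWulffConstantCoaxialWallLawSeamUnionCoreCloser
import HarnessLib

/-!
# `UnionCoreCap s` IS FALSE FOR EVERY `s`: the positivity clause fails on the bare cuboctahedral cluster
# (crux `CoaxialWallLaw`, stmt-Ventures-19481; line `WallLedgerF`, skeleton 'CoaxialWallLawCertificates' v8.2, registered stub `stub_unionCoreCap`)

HONEST FRAMING. Venture `Summits/Ventures/Crystal3D` (cell `crystal3d-full`); a REFUTATION of the named input `TailResidue.UnionCoreCap s`
('…SeamUnionCoreCloser', p734494), registered 2026-08-29T17:18Z as `Cruxes.CoaxialWallLaw.Certificates.stub_unionCoreCap : UnionCoreCap (2 * Real.sqrt 6)`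
(lane F v8.2, ruling (cclv)).  The crux `CoaxialWallLaw` is NOT refuted and NOT claimed; only this INPUT is false, and for a cheap reason (the cap table
`capTable₂` has no closed-vertex-star row, so a lone exact cluster has CAPPED pool `0` at its loaded balls while the statement demands `0 < capPool`).  The repair
(payer floor + star-site closure + E1 star row) is the subject of a separate file.  F-C1 not moved.

THE WITNESS (13 balls). `Y = insert 0 fccSlots` (the origin `q = 0` and its twelve slots; `1`-separated), frame `L = refl`, payer `z = b = slotSite 0` (a basal slot,
`5` contacts).  Then
* `(b, 0)` is an (A)-end pair of `Y` for the basal system of `L` (`0` is FULL, `d = b` is a root with the empty chain, `0 − d ∈ Y`, `b` is not moving: it has `5 < 6`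
  contacts, so it is neither full nor twin-reading, and `b + d = 2b ∉ Y` so it is not narrow; two payers by `deg b ≤ 11`) — `isEndPairA_bare`;
* hence `unionCore Y b … = Y` (`unionCore_bare_eq`: the piece of the reader placement `(0, refl)` is all of `Y`) and `0 < endMultA (unionCore …) b`;
* every ball of `Y` within `1` of `b` other than the centre has `≤ 5` core contacts (`card_contacts_bare_le_five`), so NO pattern row of `capTable₂` fires there
  (each row contains the six-slot hexagon: `capTable₂_eq_kissing_of_card_le_five`) and the centre has `12` contacts; so `capPool capTable₂ Y b ≤ 0`
  (`capPool_nonpos_of_kissing_le`) — contradicting the positivity conjunct.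
* **`not_unionCoreCap : ∀ s, ¬ UnionCoreCap s`**; `not_stub_unionCoreCap : ¬ UnionCoreCap (2 * Real.sqrt 6)` (verbatim the registered type).
-/

noncomputable section

namespace Summit.Ventures.Crystal3D.Theorems

namespace TailResidue

open Summit.Ventures.Crystal3D Finset
open scoped InnerProductSpace

/-! ### No pattern row fires at a ball with at most five core contacts -/

open scoped Classical in
/-- Six pattern slots occupied around `y` give at least six core contacts. -/
theorem six_le_card_contacts_of_slots {D : Finset (EuclideanSpace ℝ (Fin 3))} {y : EuclideanSpace ℝ (Fin 3)} (s : Finset (Fin 12)) (hs : 6 ≤ s.card)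
    (L : EuclideanSpace ℝ (Fin 3) ≃ₗᵢ[ℝ] EuclideanSpace ℝ (Fin 3)) (h : ∀ k ∈ s, y + L (slotSite k) ∈ D) :
    6 ≤ (D.filter fun q => dist y q = 1).card := by
  refine hs.trans (Finset.card_le_card_of_injOn (fun k => y + L (slotSite k)) (fun k hk => ?_) ?_)
  · rw [Finset.mem_coe, Finset.mem_filter]
    exact ⟨h k hk, dist_slotSite_eq_one L y (slotSite_mem k)⟩
  · intro k₁ _ k₂ _ hk
    exact slotSite_injective (L.injective (add_left_cancel hk))

open scoped Classical in
/-- A pattern row whose pattern is absent reads `12`. -/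
theorem patternCap_eq_twelve_of_forall_not
    {pat : (EuclideanSpace ℝ (Fin 3) ≃ₗᵢ[ℝ] EuclideanSpace ℝ (Fin 3)) → Finset (EuclideanSpace ℝ (Fin 3)) → EuclideanSpace ℝ (Fin 3) → Prop} {r : ℕ}
    {D : Finset (EuclideanSpace ℝ (Fin 3))} {y : EuclideanSpace ℝ (Fin 3)} (h : ∀ L, ¬ pat L D y) : patternCap pat r D y = 12 := by
  unfold patternCap
  rw [if_neg (not_exists.2 h)]

open scoped Classical in
/-- **At a core ball with at most five core contacts the cap table is the kissing row**: every pattern row of `capTable₂` (eleven / ten / TEN′ / nine / hexagon /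
hexagon−1) contains six occupied slots, so none fires. -/
theorem capTable₂_eq_kissing_of_card_le_five {D : Finset (EuclideanSpace ℝ (Fin 3))} {y : EuclideanSpace ℝ (Fin 3)} (h5 : (D.filter fun q => dist y q = 1).card ≤ 5) :
    capTable₂ D y = 12 - (D.filter fun q => dist y q = 1).card := by
  have h6 : ¬ 6 ≤ (D.filter fun q => dist y q = 1).card := by omega
  have hhex : (6 : ℕ) ≤ hexSix.card := by decide
  have hnine : (6 : ℕ) ≤ lowerNine.card := by decide
  have hfive : (6 : ℕ) ≤ (lowerNine.erase 0).card := by decide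
  have hsub : hexSix ⊆ lowerNine := by decide
  have hne2 : ∀ k ∈ hexSix, k ≠ (2 : Fin 12) := by decide
  have e11 : elevenCap D y = 12 :=
    patternCap_eq_twelve_of_forall_not fun L hL => h6 (six_le_card_contacts_of_slots hexSix hhex L fun k hk => hL k (hne2 k hk))
  have e10 : tenCap D y = 12 :=
    patternCap_eq_twelve_of_forall_not fun L hL => h6 (six_le_card_contacts_of_slots lowerNine hnine L hL.1)
  have e9 : nineCap D y = 12 :=
    patternCap_eq_twelve_of_forall_not fun L hL => h6 (six_le_card_contacts_of_slots lowerNine hnine L hL)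
  have eh : hexagonCap D y = 12 :=
    patternCap_eq_twelve_of_forall_not fun L hL => h6 (six_le_card_contacts_of_slots hexSix hhex L hL)
  have et : tenHcpCap D y = 12 :=
    patternCap_eq_twelve_of_forall_not fun L hL => h6 (six_le_card_contacts_of_slots lowerNine hnine L hL.1)
  have ef : hexFiveCap D y = 12 :=
    patternCap_eq_twelve_of_forall_not fun L hL =>
      h6 (six_le_card_contacts_of_slots (lowerNine.erase 0) hfive L fun k hk => hL k (mem_of_mem_erase hk) (ne_of_mem_erase hk))
  have hk : 12 - (D.filter fun q => dist y q = 1).card ≤ 12 := Nat.sub_le _ _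
  unfold capTable₂ capTable₁ capTable₀ kissingCap
  rw [e11, e10, e9, eh, et, ef]
  simp only [Nat.min_eq_left hk]

/-! ### A capped pool bounded by zero -/

open scoped Classical in
/-- **If the cap of every deficient core ball within `1` of `b` is at least its deficiency, the capped pool of `b` is `≤ 0`.** -/
theorem capPool_nonpos_of_kissing_le {cap : Finset (EuclideanSpace ℝ (Fin 3)) → EuclideanSpace ℝ (Fin 3) → ℕ} {D : Finset (EuclideanSpace ℝ (Fin 3))}
    {b : EuclideanSpace ℝ (Fin 3)}
    (h : ∀ y ∈ D, dist b y ≤ 1 → (D.filter fun q => dist y q = 1).card ≤ 11 → (12 : ℝ) - ((D.filter fun q => dist y q = 1).card : ℝ) ≤ cap D y) :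
    capPool cap D b ≤ 0 := by
  unfold capPool pooledDef
  rw [sub_nonpos]
  calc ∑ z ∈ D.filter (fun z => dist b z ≤ 1 ∧ (D.filter fun q => dist z q = 1).card ≤ 11), ((12 : ℝ) - ((D.filter fun q => dist z q = 1).card : ℝ))
      ≤ ∑ z ∈ D.filter (fun z => dist b z ≤ 1 ∧ (D.filter fun q => dist z q = 1).card ≤ 11), (cap D z : ℝ) :=
        sum_le_sum fun z hz => h z (mem_filter.1 hz).1 (mem_filter.1 hz).2.1 (mem_filter.1 hz).2.2
    _ ≤ ∑ y ∈ D.filter (fun y => dist b y ≤ 1), (cap D y : ℝ) :=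
        sum_le_sum_of_subset_of_nonneg (fun z hz => mem_filter.2 ⟨(mem_filter.1 hz).1, (mem_filter.1 hz).2.1⟩) fun _ _ _ => Nat.cast_nonneg _

/-! ### The bare cuboctahedral cluster -/

/-- Every ball of the bare cluster has norm `≤ 1`. -/
theorem norm_le_one_of_mem_bare {x : EuclideanSpace ℝ (Fin 3)} (hx : x ∈ insert (0 : EuclideanSpace ℝ (Fin 3)) fccSlots) : ‖x‖ ≤ 1 := by
  rcases mem_insert.1 hx with rfl | hx
  · simp
  · exact (norm_eq_one_of_mem_fccSlots hx).le

/-- Two balls of the bare cluster are within `2` of each other. -/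
theorem dist_le_two_of_mem_bare {x y : EuclideanSpace ℝ (Fin 3)} (hx : x ∈ insert (0 : EuclideanSpace ℝ (Fin 3)) fccSlots)
    (hy : y ∈ insert (0 : EuclideanSpace ℝ (Fin 3)) fccSlots) : dist x y ≤ 2 := by
  rw [dist_eq_norm]
  linarith [norm_sub_le x y, norm_le_one_of_mem_bare hx, norm_le_one_of_mem_bare hy]

/-- **The bare cluster is `1`-separated.** -/
theorem bare_separated : ∀ p ∈ insert (0 : EuclideanSpace ℝ (Fin 3)) fccSlots, ∀ q ∈ insert (0 : EuclideanSpace ℝ (Fin 3)) fccSlots, p ≠ q → 1 ≤ dist p q := by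
  intro p hp q hq hne
  rcases mem_insert.1 hp with rfl | hp <;> rcases mem_insert.1 hq with rfl | hq
  · exact absurd rfl hne
  · rw [dist_eq_norm, zero_sub, norm_neg, norm_eq_one_of_mem_fccSlots hq]
  · rw [dist_eq_norm, sub_zero, norm_eq_one_of_mem_fccSlots hp]
  · have hsq : dist p q ^ 2 = 2 - 2 * ⟪p, q⟫_ℝ := by
      rw [dist_eq_norm, norm_sub_sq_real, norm_eq_one_of_mem_fccSlots hp, norm_eq_one_of_mem_fccSlots hq]; ring
    have hd : 0 ≤ dist p q := dist_nonneg
    rcases inner_slots_mem hp hq with h | h | h | h | h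
    · exact absurd (eq_of_inner_eq_one hp hq h).symm hne
    all_goals
      rw [h] at hsq
      nlinarith [hsq, hd]

open scoped Classical in
/-- **A slot of the bare cluster has at most five contacts in it** (the centre and the four adjacent slots: the closed vertex star minus itself, plus the centre). -/
theorem card_contacts_bare_le_five {w : EuclideanSpace ℝ (Fin 3)} (hw : w ∈ fccSlots) :
    ((insert (0 : EuclideanSpace ℝ (Fin 3)) fccSlots).filter fun q => dist w q = 1).card ≤ 5 := by
  have hsub : (insert (0 : EuclideanSpace ℝ (Fin 3)) fccSlots).filter (fun q => dist w q = 1) ⊆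
      insert 0 ((fccSlots.filter fun u => 0 < ⟪u, w⟫_ℝ).erase w) := by
    intro x hx
    obtain ⟨hx, hd⟩ := mem_filter.1 hx
    rcases mem_insert.1 hx with rfl | hx
    · exact mem_insert_self _ _
    · refine mem_insert_of_mem (mem_erase.2 ⟨?_, mem_filter.2 ⟨hx, ?_⟩⟩)
      · rintro rfl
        rw [dist_self] at hd
        exact zero_ne_one hd
      · have h2 : dist w x ^ 2 = 1 := by rw [hd]; norm_num
        rw [dist_eq_norm, norm_sub_sq_real, norm_eq_one_of_mem_fccSlots hw, norm_eq_one_of_mem_fccSlots hx, real_inner_comm] at h2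
        linarith
  have hwstar : w ∈ fccSlots.filter fun u => 0 < ⟪u, w⟫_ℝ :=
    mem_filter.2 ⟨hw, by rw [real_inner_self_eq_norm_sq, norm_eq_one_of_mem_fccSlots hw]; norm_num⟩
  calc ((insert (0 : EuclideanSpace ℝ (Fin 3)) fccSlots).filter fun q => dist w q = 1).card
      ≤ (insert (0 : EuclideanSpace ℝ (Fin 3)) ((fccSlots.filter fun u => 0 < ⟪u, w⟫_ℝ).erase w)).card := card_le_card hsub
    _ ≤ ((fccSlots.filter fun u => 0 < ⟪u, w⟫_ℝ).erase w).card + 1 := card_insert_le _ _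
    _ = 5 := by rw [card_erase_of_mem hwstar, card_star_eq_five hw]

open scoped Classical in
/-- The centre of the bare cluster has twelve contacts. -/
theorem twelve_le_card_contacts_bare_zero :
    12 ≤ ((insert (0 : EuclideanSpace ℝ (Fin 3)) fccSlots).filter fun q => dist (0 : EuclideanSpace ℝ (Fin 3)) q = 1).card :=
  twelve_le_card_contacts_of_full (LinearIsometryEquiv.refl ℝ (EuclideanSpace ℝ (Fin 3))) fun w hw => by
    simpa using mem_insert_of_mem hw

/-- `slotSite 0` is a basal slot. -/
theorem slotSite_zero_mem_basalHexagon : slotSite 0 ∈ basalHexagon := by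
  rw [basalHexagon, mem_filter]
  refine ⟨slotSite_mem 0, ?_⟩
  rw [slotSite, Literature.MathematicalPhysics.StatisticalMechanics.barlowPos_apply_two]
  simp [slotKIJ]

/-! ### The (A)-end pair `(b, 0)` and the union core of the bare cluster -/

section Witness

/-- The payer / end ball of the witness: the basal slot `slotSite 0`. -/
private theorem b_mem : slotSite 0 ∈ insert (0 : EuclideanSpace ℝ (Fin 3)) fccSlots := mem_insert_of_mem (slotSite_mem 0)

open scoped Classical in
/-- The payer has at most five (hence `≤ 11`) contacts. -/
theorem card_contacts_b_le_five : ((insert (0 : EuclideanSpace ℝ (Fin 3)) fccSlots).filter fun q => dist (slotSite 0) q = 1).card ≤ 5 :=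
  card_contacts_bare_le_five (slotSite_mem 0)

open scoped Classical in
/-- **The end ball `b = slotSite 0` is not moving** in the bare cluster (frame `refl`, direction `b`, version `v2`). -/
theorem not_isMoving_bare : ¬ IsMoving (insert (0 : EuclideanSpace ℝ (Fin 3)) fccSlots) WordVersion.v2 (LinearIsometryEquiv.refl ℝ (EuclideanSpace ℝ (Fin 3)))
    (slotSite 0) (slotSite 0) := by
  set Y := insert (0 : EuclideanSpace ℝ (Fin 3)) fccSlots with hY
  have h5 := card_contacts_b_le_five
  rintro (hfull | ⟨m, htw, -⟩ | ⟨-, hnar⟩)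
  · -- full: twelve contacts
    have h12 := twelve_le_card_contacts_of_full (X := Y) (LinearIsometryEquiv.refl ℝ (EuclideanSpace ℝ (Fin 3))) hfull
    rw [hY] at h12
    omega
  · -- twin reading: the nine non-positive slots of the menu normal are occupied
    obtain ⟨⟨hm1, hmenu⟩, hown, -, -⟩ := htw
    obtain ⟨u₁, -, u₂, -, u₃, -, -, -, -, -, -, -, -, huniq⟩ := exists_far_frame (LinearIsometryEquiv.refl ℝ (EuclideanSpace ℝ (Fin 3))) hm1 hmenu
    have hcard : 6 ≤ (fccSlots.filter fun w => ⟪(LinearIsometryEquiv.refl ℝ (EuclideanSpace ℝ (Fin 3))) w, m⟫_ℝ ≤ 0).card := by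
      have hpos : (fccSlots.filter fun w => ¬ ⟪(LinearIsometryEquiv.refl ℝ (EuclideanSpace ℝ (Fin 3))) w, m⟫_ℝ ≤ 0) ⊆ {u₁, u₂, u₃} := by
        intro w hw
        obtain ⟨hw, hlt⟩ := mem_filter.1 hw
        rcases huniq w hw (lt_of_not_ge hlt) with rfl | rfl | rfl <;> simp
      have h3 : (fccSlots.filter fun w => ¬ ⟪(LinearIsometryEquiv.refl ℝ (EuclideanSpace ℝ (Fin 3))) w, m⟫_ℝ ≤ 0).card ≤ 3 :=
        (card_le_card hpos).trans card_le_three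
      have hsplit := card_filter_add_card_filter_not (s := fccSlots) fun w => ⟪(LinearIsometryEquiv.refl ℝ (EuclideanSpace ℝ (Fin 3))) w, m⟫_ℝ ≤ 0
      rw [card_fccSlots] at hsplit
      omega
    have h6 : 6 ≤ (Y.filter fun q => dist (slotSite 0) q = 1).card := by
      refine hcard.trans (Finset.card_le_card_of_injOn (fun w => slotSite 0 + (LinearIsometryEquiv.refl ℝ (EuclideanSpace ℝ (Fin 3))) w) (fun w hw => ?_) ?_)
      · rw [Finset.mem_coe, Finset.mem_filter] at hw ⊢
        exact ⟨hown w hw.1 hw.2, dist_slotSite_eq_one _ _ hw.1⟩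
      · intro w₁ _ w₂ _ h
        exact (LinearIsometryEquiv.refl ℝ (EuclideanSpace ℝ (Fin 3))).injective (add_left_cancel h)
    rw [hY] at h6
    omega
  · -- narrow: `b + b ∈ Y` is impossible (norm `2`)
    have hmem := hnar.1
    have hn : ‖slotSite 0 + slotSite 0‖ = 2 := by
      rw [← two_smul ℝ (slotSite 0), norm_smul, Real.norm_two, norm_eq_one_of_mem_fccSlots (slotSite_mem 0), mul_one]
    have := norm_le_one_of_mem_bare hmem
    linarith

/-- The direction `b = slotSite 0` is admissible for the basal system of the identity frame (empty chain). -/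
theorem adm_bare : (basalSystem (LinearIsometryEquiv.refl ℝ (EuclideanSpace ℝ (Fin 3)))).Adm (LinearIsometryEquiv.refl ℝ (EuclideanSpace ℝ (Fin 3)))
    (slotSite 0) := by
  refine ⟨slotSite 0, slotSite_zero_mem_basalHexagon, [], ?_, ?_, ?_⟩
  · simp only [WFChain]
  · simp only [PlateSystem.Fw, basalSystem]
  · simp only [PlateSystem.Fw, basalSystem, List.length_nil, pow_zero, one_smul, LinearIsometryEquiv.coe_refl, id_eq]

/-- The centre of the bare cluster is FULL in the identity frame. -/
theorem isFull_bare_zero : IsFull (insert (0 : EuclideanSpace ℝ (Fin 3)) fccSlots) (LinearIsometryEquiv.refl ℝ (EuclideanSpace ℝ (Fin 3))) 0 :=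
  fun w hw => by simpa using mem_insert_of_mem hw

/-- The predecessor ball `0 − b` is in the bare cluster. -/
theorem zero_sub_b_mem : (0 : EuclideanSpace ℝ (Fin 3)) - slotSite 0 ∈ insert (0 : EuclideanSpace ℝ (Fin 3)) fccSlots := by
  rw [zero_sub]
  exact mem_insert_of_mem (neg_mem_fccSlots (slotSite_mem 0))

open scoped Classical in
/-- **`(b, 0)` is an (A)-end pair of the bare cluster** for the basal system of the identity frame in the first slot (any second system). -/
theorem isEndPairA_bare (S₂ : PlateSystem) :
    IsEndPairA (insert (0 : EuclideanSpace ℝ (Fin 3)) fccSlots) WordVersion.v2 (basalSystem (LinearIsometryEquiv.refl ℝ (EuclideanSpace ℝ (Fin 3)))) S₂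
      (slotSite 0) 0 :=
  ⟨mem_insert_self _ _, b_mem, Or.inl (card_contacts_b_le_five.trans (by norm_num)), LinearIsometryEquiv.refl ℝ (EuclideanSpace ℝ (Fin 3)),
    slotSite 0, Or.inl adm_bare, zero_sub_b_mem, Or.inl ⟨Or.inl isFull_bare_zero, by simp, not_isMoving_bare⟩⟩

open scoped Classical in
/-- The bare cluster is contained in the piece of the reader placement `(0, refl)` in the payer window of `b`. -/
theorem bare_subset_pieceOf : insert (0 : EuclideanSpace ℝ (Fin 3)) fccSlots ⊆
    pieceOf (insert (0 : EuclideanSpace ℝ (Fin 3)) fccSlots) (slotSite 0) 0 (LinearIsometryEquiv.refl ℝ (EuclideanSpace ℝ (Fin 3))) := by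
  intro x hx
  refine mem_pieceOf_of_module _ hx ((dist_le_two_of_mem_bare b_mem hx).trans (by norm_num)) ?_
  rcases mem_insert.1 hx with rfl | hx'
  · simp only [sub_self, map_zero]
    exact ⟨0, 0, 0, 0, by simp⟩
  · rw [sub_zero]
    exact slot_mem_module hx'

open scoped Classical in
/-- **The union core of the payer `b` in the bare cluster is the whole cluster** (identity frame's basal system in the first slot, any second system with slot roots). -/
theorem unionCore_bare_eq {S₂ : PlateSystem} (h₂ : S₂.RT ⊆ fccSlots) :
    unionCore (insert (0 : EuclideanSpace ℝ (Fin 3)) fccSlots) (slotSite 0) WordVersion.v2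
        (basalSystem (LinearIsometryEquiv.refl ℝ (EuclideanSpace ℝ (Fin 3)))) S₂ =
      insert (0 : EuclideanSpace ℝ (Fin 3)) fccSlots := by
  have h₁ : (basalSystem (LinearIsometryEquiv.refl ℝ (EuclideanSpace ℝ (Fin 3)))).RT ⊆ fccSlots := filter_subset _ _
  have hzb : dist (slotSite 0) (slotSite 0) ≤ 1 := by simp
  refine Subset.antisymm isCapClosed_unionCore.subset fun x hx => ?_
  have hpP := isEndPairA_pieceOf_of_straight (v := WordVersion.v2) (z := slotSite 0) bare_separated h₁ h₂ hzb (mem_insert_self _ _) b_mem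
    (Or.inl (card_contacts_b_le_five.trans (by norm_num))) (Or.inl adm_bare) zero_sub_b_mem (Or.inl isFull_bare_zero) (by simp) not_isMoving_bare
  exact pieceOf_subset_unionCore hzb (isEndPairA_bare S₂) hpP (bare_subset_pieceOf hx)

/-! ### The refutation -/

open scoped Classical in
/-- **`UnionCoreCap s` is false for every `s`.**  In the bare cluster with the identity frame, the payer `b = slotSite 0` is a loaded ball of its own union core
(`= the cluster`) whose capped pool is `0`: the centre has twelve core contacts and the other balls within `1` of `b` have five, so no pattern row fires and the
caps equal the deficiencies. -/
theorem not_unionCoreCap (s : ℝ) : ¬ UnionCoreCap s := by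
  intro h
  have h₂ : (basalSystem (((ℝ ∙ EuclideanSpace.single (2 : Fin 3) (1 : ℝ)).reflection).trans
      (LinearIsometryEquiv.refl ℝ (EuclideanSpace ℝ (Fin 3))))).RT ⊆ fccSlots := filter_subset _ _
  have hUC := unionCore_bare_eq h₂
  obtain ⟨hpos, -⟩ := h (LinearIsometryEquiv.refl ℝ (EuclideanSpace ℝ (Fin 3))) (insert (0 : EuclideanSpace ℝ (Fin 3)) fccSlots) bare_separated
    (slotSite 0) b_mem (card_contacts_b_le_five.trans (by norm_num))
  rw [hUC] at hpos
  have hend : 0 < endMultA (insert (0 : EuclideanSpace ℝ (Fin 3)) fccSlots) WordVersion.v2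
      (basalSystem (LinearIsometryEquiv.refl ℝ (EuclideanSpace ℝ (Fin 3))))
      (basalSystem (((ℝ ∙ EuclideanSpace.single (2 : Fin 3) (1 : ℝ)).reflection).trans (LinearIsometryEquiv.refl ℝ (EuclideanSpace ℝ (Fin 3)))))
      (slotSite 0) :=
    card_pos.2 ⟨0, mem_filter.2 ⟨mem_insert_self _ _, isEndPairA_bare _⟩⟩
  have hle : capPool capTable₂ (insert (0 : EuclideanSpace ℝ (Fin 3)) fccSlots) (slotSite 0) ≤ 0 := by
    refine capPool_nonpos_of_kissing_le fun y hy _ hdeg => ?_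
    rcases mem_insert.1 hy with rfl | hy'
    · have h12 := twelve_le_card_contacts_bare_zero
      omega
    · have h5 := card_contacts_bare_le_five hy'
      rw [capTable₂_eq_kissing_of_card_le_five h5, Nat.cast_sub (by omega)]
      norm_num
  exact absurd (hpos (slotSite 0) b_mem (by simp) hend) (not_lt.2 hle)

/-- **The registered stub `Cruxes.CoaxialWallLaw.Certificates.stub_unionCoreCap : UnionCoreCap (2 * Real.sqrt 6)` (lane F v8.2) is false** — verbatim its type. -/
theorem not_stub_unionCoreCap : ¬ UnionCoreCap (2 * Real.sqrt 6) := not_unionCoreCap _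

end Witness

end TailResidue

end Summit.Ventures.Crystal3D.Theorems

end
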